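import Summits.KontsevichZagierPeriods.KontsevichZagierPeriods.Theorems.EllipticMomentKernel.Negative.Strengthenings

/-!
# `EllipticMomentKernel` (stmt-KontsevichZagierPeriods-10631) — negative knowledge, part 5: the Hermite step is one legal Newton–Leibniz move

Positive control on the model curve `y² = 4x³ − 4x`: `hermiteElem_mem_relations :
3[σ, x²/√f] − [σ, 1/√f] ∈ KZ.relations`, derived INSIDE the calculus by one `newtonLeibnizRel`
instance on the CLOSED band `[−1, 0] ⊆ ℝ¹` over the base `ℝ⁰` (primitive `√f/2`, continuous on
the closed fibre, derivative the unbounded integrand on the open fibre; the integrand is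
semialgebraic on the closed band by gluing its junk value `0` at the branch points, and integrable
there because the branch points are null), one domain-additivity move (closed band vs open oval),
one integrand-additivity move, and the tree's integer-scaling bookkeeping. Model instance of the
support item `HermiteExactFormVanishes` (`P = 1`); settles the planner's legality worry ("closed
band `[e₃,e₂]` vs open `σ`, integrability of `(P′f+Pf′/2)/√f` at the roots") on the model. [folklore]
-/

noncomputable section

open MeasureTheory Set
open scoped BigOperators

namespace Summit.KontsevichZagierPeriods.HermiteRigidity.EllipticMomentKernelNegative

open Literature.NumberTheory.Transcendental
open Literature.NumberTheory.Transcendental.KZ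
open Summit.KontsevichZagierPeriods.KontsevichZagierPeriods.Theses.HermiteRigidity (EllipticMomentKernel)

section ModelCurve

open Literature.ModelTheory.ExponentialFields (IsSemialgebraic isSemialgebraic_setOf_eval_pos)
open MvPolynomial (aeval X C)

/-! ### §5 Positive control: the predicted relation `c₀ ∈ KZ.relations` IS derivable — one
Newton–Leibniz move on the CLOSED band `[−1, 0]` over the point `ℝ⁰`, plus bookkeeping -/

open Literature.ModelTheory.ExponentialFields (isSemialgebraic_setOf_eval_eq_zero isSemialgebraic_univ)

/-- The Hermite exact form as a function on `ℝ¹`. [folklore] -/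
def hermiteForm (z : Fin 1 → ℝ) : ℝ := (3 * z 0 ^ 2 - 1) / Real.sqrt (cubic 4 0 (z 0))

/-- The closed band `[−1, 0] ⊆ ℝ¹`, written in the literal shape of `KZ.newtonLeibnizRel` over the
base `univ ⊆ ℝ⁰` with the constant bounds `a = −1`, `b = 0`. [folklore] -/
def band : Set (Fin 1 → ℝ) :=
  {z | (Fin.init z : Fin 0 → ℝ) ∈ (univ : Set (Fin 0 → ℝ)) ∧
    (fun _ => (-1 : ℝ)) (Fin.init z) ≤ z (Fin.last 0) ∧ z (Fin.last 0) ≤ (fun _ => (0 : ℝ)) (Fin.init z)}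

/-- The two branch points `{−1, 0} ⊆ ℝ¹`. [folklore] -/
def ends : Set (Fin 1 → ℝ) := {z | z 0 = -1 ∨ z 0 = 0}

/-- `band = [−1, 0]`. [folklore] -/
theorem band_eq : band = {z : Fin 1 → ℝ | -1 ≤ z 0 ∧ z 0 ≤ 0} := by
  ext z; simp [band]

/-- `[−1, 0] = (−1, 0) ∪ {−1, 0}`. [folklore] -/
theorem band_eq_union : band = oval 4 0 ∪ ends := by
  rw [band_eq, oval_four_zero]
  ext z
  simp only [mem_setOf_eq, mem_union, ends]
  constructor
  · rintro ⟨h1, h2⟩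
    rcases h1.lt_or_eq with h1 | h1
    · rcases h2.lt_or_eq with h2 | h2
      · exact Or.inl ⟨h1, h2⟩
      · exact Or.inr (Or.inr h2)
    · exact Or.inr (Or.inl h1.symm)
  · rintro (⟨h1, h2⟩ | h | h)
    · exact ⟨h1.le, h2.le⟩
    · rw [h]; norm_num
    · rw [h]; norm_num

/-- `ends` is `ℚ`-semialgebraic (zero set of `(X + 1)·X`). [folklore] -/
theorem isSemialgebraic_ends : Literature.ModelTheory.ExponentialFields.IsSemialgebraic ℚ ends := by
  have h := isSemialgebraic_setOf_eval_eq_zero (k := ℚ) (R := ℝ)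
    ((X 0 + 1) * X 0 : MvPolynomial (Fin 1) ℚ)
  convert h using 1
  ext z
  simp only [ends, mem_setOf_eq, map_mul, map_add, MvPolynomial.aeval_X, map_one, mul_eq_zero]
  constructor
  · rintro (h | h)
    · exact Or.inl (by rw [h]; ring)
    · exact Or.inr h
  · rintro (h | h)
    · exact Or.inl (by linarith)
    · exact Or.inr h

/-- `ends` is a two-point set, hence Lebesgue-null in `ℝ¹`. [folklore] -/
theorem volume_ends : volume ends = 0 := by
  have : ends = {fun _ => -1, fun _ => 0} := by
    ext z; simp [ends, funext_iff, Fin.forall_fin_one]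
  rw [this]
  exact (Set.toFinite _).measure_zero _

/-- The band is `ℚ`-semialgebraic. [folklore] -/
theorem isSemialgebraic_band : Literature.ModelTheory.ExponentialFields.IsSemialgebraic ℚ band := by
  rw [band_eq_union]; exact isSemialgebraic_oval_four_zero.union isSemialgebraic_ends

/-- At the branch points the (junk-valued) Hermite form vanishes: `(3x² − 1)/√0 = 0`. [folklore] -/
theorem hermiteForm_eq_zero_of_mem_ends {z : Fin 1 → ℝ} (hz : z ∈ ends) : hermiteForm z = 0 := by
  have : cubic 4 0 (z 0) = 0 := by
    rcases hz with h | h <;> rw [h, cubic_four_zero] <;> norm_num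
  simp [hermiteForm, this]

/-- The Hermite form is `ℚ`-semialgebraic on the open oval (`(3x² − 1)·√(1/f)`). [folklore] -/
theorem isSemialgebraicFunOn_hermiteForm_oval : IsSemialgebraicFunOn ℚ (oval 4 0) hermiteForm := by
  have hs := isSemialgebraic_oval_four_zero
  have h1 : IsSemialgebraicFunOn ℚ (oval 4 0)
      (fun p => aeval p (3 * X 0 ^ 2 - 1 : MvPolynomial (Fin 1) ℚ)) := isSemialgebraicFunOn_aeval hs _
  have h2 : IsSemialgebraicFunOn ℚ (oval 4 0)
      (fun p => aeval p (1 : MvPolynomial (Fin 1) ℚ) / aeval p cubicPoly) :=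
    isSemialgebraicFunOn_aeval_div_aeval hs _ _ fun p hp => by
      rw [aeval_cubicPoly]; exact hp.1.ne'
  have h4 := IsSemialgebraicFunOn.mul_holds h1 (IsSemialgebraicFunOn.sqrt_holds h2)
  refine h4.congr fun p hp => ?_
  simp only [Pi.mul_apply, map_sub, map_mul, map_pow, MvPolynomial.aeval_X, map_one,
    aeval_cubicPoly, hermiteForm, map_ofNat]
  rw [Real.sqrt_div' _ hp.1.le, Real.sqrt_one, mul_one_div]

/-- The Hermite form is `ℚ`-semialgebraic on the two branch points (it is `0` there). [folklore] -/
theorem isSemialgebraicFunOn_hermiteForm_ends : IsSemialgebraicFunOn ℚ ends hermiteForm :=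
  (isSemialgebraicFunOn_aeval isSemialgebraic_ends (0 : MvPolynomial (Fin 1) ℚ)).congr
    fun z hz => by simp [hermiteForm_eq_zero_of_mem_ends hz]

/-- **The Hermite form is `ℚ`-semialgebraic on the CLOSED band** (gluing, the tree's
`IsSemialgebraicFunOn.union`). [folklore] -/
theorem isSemialgebraicFunOn_hermiteForm_band : IsSemialgebraicFunOn ℚ band hermiteForm := by
  rw [band_eq_union]
  exact IsSemialgebraicFunOn.union isSemialgebraicFunOn_hermiteForm_oval
    isSemialgebraicFunOn_hermiteForm_ends (fun _ _ => rfl) (fun _ _ => rfl)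

/-- Integrability of the Hermite form on the oval in `ℝ¹`. [folklore] -/
theorem integrableOn_hermiteForm_oval : IntegrableOn hermiteForm (oval 4 0) := by
  rw [oval_eq_preimage]
  exact (measurePreserving_e1.integrableOn_comp_preimage e1.measurableEmbedding).mpr
    integrableOn_hermiteForm

/-- Integrability of the Hermite form on the null set `ends`. [folklore] -/
theorem integrableOn_hermiteForm_ends : IntegrableOn hermiteForm ends := by
  rw [IntegrableOn, Measure.restrict_eq_zero.2 volume_ends]
  exact integrable_zero_measure

/-- **Integrability of the Hermite form on the closed band** (unbounded at both ends). [folklore] -/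
theorem integrableOn_hermiteForm_band : IntegrableOn hermiteForm band := by
  rw [band_eq_union]; exact integrableOn_hermiteForm_oval.union integrableOn_hermiteForm_ends

/-- The band representation `[[−1,0], (3x² − 1)/√f]` — the `r` of the Newton–Leibniz move. [folklore] -/
def bandRep : IntegralRep 1 where
  domain := band
  integrand := hermiteForm
  isSemialgebraic_domain := isSemialgebraic_band
  isSemialgebraicFunOn_integrand := isSemialgebraicFunOn_hermiteForm_band
  integrableOn := integrableOn_hermiteForm_band

/-- The open-oval representation `[(−1,0), (3x² − 1)/√f]`. [folklore] -/
def ovalRep : IntegralRep 1 where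
  domain := oval 4 0
  integrand := hermiteForm
  isSemialgebraic_domain := isSemialgebraic_oval_four_zero
  isSemialgebraicFunOn_integrand := isSemialgebraicFunOn_hermiteForm_oval
  integrableOn := integrableOn_hermiteForm_oval

/-- The null representation on the two branch points. [folklore] -/
def endsRep : IntegralRep 1 where
  domain := ends
  integrand := hermiteForm
  isSemialgebraic_domain := isSemialgebraic_ends
  isSemialgebraicFunOn_integrand := isSemialgebraicFunOn_hermiteForm_ends
  integrableOn := integrableOn_hermiteForm_ends

/-- The base of the move: the point `ℝ⁰` with integrand `0` (`= F(0) − F(−1)` for `F = √f/2`).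
[folklore] -/
def baseRep : IntegralRep 0 where
  domain := univ
  integrand := fun _ => 0
  isSemialgebraic_domain := isSemialgebraic_univ
  isSemialgebraicFunOn_integrand :=
    (isSemialgebraicFunOn_aeval isSemialgebraic_univ (0 : MvPolynomial (Fin 0) ℚ)).congr
      fun _ _ => by simp
  integrableOn := integrableOn_zero

/-- `Fin.snoc` into `ℝ¹` from `ℝ⁰`. [folklore] -/
theorem snoc_apply_zero (x : Fin 0 → ℝ) (t : ℝ) : (Fin.snoc x t : Fin 1 → ℝ) 0 = t := rfl

/-- **The Hermite step is ONE legal Newton–Leibniz move**: `[bandRep] − [baseRep] ∈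
KZ.newtonLeibnizRel` with `a = −1`, `b = 0`, primitive `F = √f/2` — `ℚ`-semialgebraic on the band,
continuous on the CLOSED fibre `[−1, 0]`, with derivative the (unbounded) integrand on the OPEN
fibre, `F(0) − F(−1) = 0`. This is the model instance of the support item
`HermiteExactFormVanishes` (`P = 1`) and settles the planner's legality worry on the model.
[cite: KontsevichZagier2001, §1.2 rule (3)] -/
theorem of_bandRep_sub_of_baseRep_mem_newtonLeibnizRel :
    KZ.of bandRep - KZ.of baseRep ∈ newtonLeibnizRel := by
  refine ⟨0, bandRep, baseRep, fun _ => -1, fun _ => 0, fun z => Real.sqrt (cubic 4 0 (z 0)) / 2,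
    ?_, ?_, ?_, fun _ _ => by norm_num, rfl, ?_, ?_, ?_, rfl⟩
  · -- `F = (1/2)·√f` is semialgebraic on the band
    have hF1 : IsSemialgebraicFunOn ℚ band (fun z => Real.sqrt (aeval z cubicPoly)) :=
      IsSemialgebraicFunOn.sqrt_holds (isSemialgebraicFunOn_aeval isSemialgebraic_band cubicPoly)
    have hc : IsSemialgebraicFunOn ℚ band (fun _ => (1 / 2 : ℝ)) := by
      refine isSemialgebraicFunOn_const_of_isAlgebraic isSemialgebraic_band ?_
      have h2 : IsAlgebraic ℚ (((2 : ℕ) : ℝ)⁻¹) := (isAlgebraic_nat 2).inv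
      simpa [one_div] using h2
    refine (IsSemialgebraicFunOn.mul_holds hc hF1).congr fun z _ => ?_
    simp only [Pi.mul_apply, aeval_cubicPoly]
    show 1 / 2 * Real.sqrt (cubic 4 0 (z 0)) = Real.sqrt (cubic 4 0 (z 0)) / 2
    ring
  · exact (isSemialgebraicFunOn_aeval isSemialgebraic_univ
      (MvPolynomial.C (-1) : MvPolynomial (Fin 0) ℚ)).congr fun _ _ => by simp
  · exact (isSemialgebraicFunOn_aeval isSemialgebraic_univ (0 : MvPolynomial (Fin 0) ℚ)).congr
      fun _ _ => by simp
  · intro x _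
    show ContinuousOn (fun t : ℝ => Real.sqrt (cubic 4 0 ((Fin.snoc x t : Fin 1 → ℝ) 0)) / 2) _
    simp only [snoc_apply_zero]
    exact ((Real.continuous_sqrt.comp continuous_cubic).div_const 2).continuousOn
  · intro x _ t ht
    show HasDerivAt (fun s : ℝ => Real.sqrt (cubic 4 0 ((Fin.snoc x s : Fin 1 → ℝ) 0)) / 2)
      (hermiteForm (Fin.snoc x t)) t
    simp only [hermiteForm, snoc_apply_zero]
    exact hasDerivAt_half_sqrt_cubic ht
  · intro x _
    show (0 : ℝ) = Real.sqrt (cubic 4 0 ((Fin.snoc x ((fun _ => (0 : ℝ)) x) : Fin 1 → ℝ) 0)) / 2 -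
      Real.sqrt (cubic 4 0 ((Fin.snoc x ((fun _ => (-1 : ℝ)) x) : Fin 1 → ℝ) 0)) / 2
    simp only [snoc_apply_zero, cubic_four_zero]
    norm_num

/-- A representation with zero integrand is a relation (`[z] − [z] − [z]` is an
integrand-additivity instance). [folklore] -/
theorem of_baseRep_mem_relations : KZ.of baseRep ∈ relations := by
  have h : KZ.of baseRep - KZ.of baseRep - KZ.of baseRep ∈ integrandAddRel :=
    ⟨0, baseRep, baseRep, baseRep, rfl, rfl, fun x _ => by simp [baseRep], rfl⟩
  have h' := integrandAddRel_subset_relations h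
  rw [sub_self, zero_sub] at h'
  simpa using relations.neg_mem h'

/-- `[bandRep] ∈ relations`. [folklore] -/
theorem of_bandRep_mem_relations : KZ.of bandRep ∈ relations := by
  have h1 := newtonLeibnizRel_subset_relations of_bandRep_sub_of_baseRep_mem_newtonLeibnizRel
  simpa using relations.add_mem h1 of_baseRep_mem_relations

/-- A representation on a null domain is a relation (`[e] − [e] − [e]` is a domain-additivity
instance). [folklore] -/
theorem of_endsRep_mem_relations : KZ.of endsRep ∈ relations := by
  have h : KZ.of endsRep - KZ.of endsRep - KZ.of endsRep ∈ domainAddRel :=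
    ⟨1, endsRep, endsRep, endsRep, (union_self _).symm, by simpa [endsRep] using volume_ends,
      fun _ _ => rfl, fun _ _ => rfl, rfl⟩
  have h' := domainAddRel_subset_relations h
  rw [sub_self, zero_sub] at h'
  simpa using relations.neg_mem h'

/-- Closed band versus open oval: ONE domain-additivity move. [folklore] -/
theorem of_bandRep_sub_sub_mem_domainAddRel :
    KZ.of bandRep - KZ.of ovalRep - KZ.of endsRep ∈ domainAddRel :=
  ⟨1, bandRep, ovalRep, endsRep, band_eq_union,
    measure_mono_null inter_subset_right volume_ends, fun _ _ => rfl, fun _ _ => rfl, rfl⟩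

/-- `[ovalRep] ∈ relations`. [folklore] -/
theorem of_ovalRep_mem_relations : KZ.of ovalRep ∈ relations := by
  have h1 := domainAddRel_subset_relations of_bandRep_sub_sub_mem_domainAddRel
  have h2 : KZ.of ovalRep = KZ.of bandRep - (KZ.of bandRep - KZ.of ovalRep - KZ.of endsRep) -
      KZ.of endsRep := by abel
  rw [h2]
  exact relations.sub_mem (relations.sub_mem of_bandRep_mem_relations h1) of_endsRep_mem_relations

/-- `[ovalRep] − [3·genRep 2] − [−genRep 0]` is ONE integrand-additivity move
(`(3x² − 1)/√f = 3·(x²/√f) + (−(1/√f))` on the oval). [folklore] -/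
theorem of_ovalRep_sub_sub_mem_integrandAddRel :
    KZ.of ovalRep - KZ.of ((genRep 2).constMul ((3 : ℕ) : ℝ) (isAlgebraic_nat 3)) -
      KZ.of (genRep 0).neg ∈ integrandAddRel := by
  refine ⟨1, ovalRep, (genRep 2).constMul ((3 : ℕ) : ℝ) (isAlgebraic_nat 3), (genRep 0).neg,
    rfl, rfl, fun z _ => ?_, rfl⟩
  simp only [Pi.add_apply, IntegralRep.integrand_constMul, IntegralRep.integrand_neg,
    Pi.neg_apply, Nat.cast_ofNat]
  show hermiteForm z = 3 * (z 0 ^ 2 / Real.sqrt (cubic 4 0 (z 0))) +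
    -(z 0 ^ 0 / Real.sqrt (cubic 4 0 (z 0)))
  simp only [hermiteForm, pow_zero]
  ring

/-- `[−r] + [r]` is a relation (integrand additivity with the zero representation on the same
domain). [folklore] -/
theorem of_neg_add_of_mem_relations {n : ℕ} (r : IntegralRep n) :
    KZ.of r.neg + KZ.of r ∈ relations := by
  set z := r.constMul ((0 : ℕ) : ℝ) (isAlgebraic_nat 0) with hz
  have h0 : KZ.of z ∈ relations := by
    simpa [z] using IntegralRep.of_constMul_nat_sub_nsmul_mem_relations r 0
  have h1 : KZ.of z - KZ.of r - KZ.of r.neg ∈ integrandAddRel :=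
    ⟨n, z, r, r.neg, rfl, rfl, fun x _ => by simp [z], rfl⟩
  have h2 := integrandAddRel_subset_relations h1
  have h3 : KZ.of r.neg + KZ.of r = KZ.of z - (KZ.of z - KZ.of r - KZ.of r.neg) := by abel
  rw [h3]
  exact relations.sub_mem h0 h2

/-- **`c₀ = 3[σ, x²/√f] − [σ, 1/√f] ∈ KZ.relations`**: the relation the crux predicts on the model
curve is derivable — one Newton–Leibniz move across the branch points, one domain-additivity move
(closed band vs open oval, null difference), one integrand-additivity move, and the integer-scaling
bookkeeping `[σ, 3g] ~ 3•[σ, g]` (tree: `of_constMul_nat_sub_nsmul_mem_relations`). Together with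
§4: `c₀ ∈ relations`, `c₀ ∉ ⟨(1a),(1b)⟩`, `c₀ ∉ ⟨(2),(3)⟩`. [folklore] -/
theorem hermiteElem_mem_relations : hermiteElem ∈ relations := by
  have hA := of_ovalRep_mem_relations
  have hB := integrandAddRel_subset_relations of_ovalRep_sub_sub_mem_integrandAddRel
  have hC := IntegralRep.of_constMul_nat_sub_nsmul_mem_relations (genRep 2) 3
  have hD := of_neg_add_of_mem_relations (genRep 0)
  have h : hermiteElem = KZ.of ovalRep -
      (KZ.of ovalRep - KZ.of ((genRep 2).constMul ((3 : ℕ) : ℝ) (isAlgebraic_nat 3)) -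
        KZ.of (genRep 0).neg) -
      (KZ.of ((genRep 2).constMul ((3 : ℕ) : ℝ) (isAlgebraic_nat 3)) - 3 • KZ.of (genRep 2)) -
      (KZ.of (genRep 0).neg + KZ.of (genRep 0)) := by
    simp only [hermiteElem]; abel
  rw [h]
  exact relations.sub_mem (relations.sub_mem (relations.sub_mem hA hB) hC) hD

/-- Equivalently: `[σ, x²/√f]` taken three times is KZ-equivalent to `[σ, 1/√f]` — `3J₂ = J₀` as a
derivation, not only as an equality of values. [folklore] -/
theorem three_nsmul_of_genRep_two_sub_mem_relations :
    3 • KZ.of (genRep 2) - KZ.of (genRep 0) ∈ relations := hermiteElem_mem_relations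

end ModelCurve

end Summit.KontsevichZagierPeriods.HermiteRigidity.EllipticMomentKernelNegative
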